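import Literature.AlgebraicGeometry.Motives.WeilDiscriminantTypeIIModel
import Literature.AlgebraicGeometry.Motives.WeilHermitianLandherrUniqueness
import HarnessLib

/-!
# Every Weil form of odd half-rank carries a type-II structure: `det H = [u]`, `u < 0` ⟹ a
# Rosati-symmetric `K`-antilinear `j` with `j² = -u` (Landherr transport of the type-II model)

Family `hodge`, layer `Literature/AlgebraicGeometry/Motives`; THEOREMS ONLY (no definition, no named fact,
no `sorry`; D-0026). Puts together `Motives/WeilDiscriminantTypeIIModel` (the model
`diag(1, …, 1, -b, …, -b)` with its explicit Rosati-symmetric `K`-antilinear `j`, `j² = b`, signature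
`(n, n)`, `det H = (-b)ⁿ`; for odd `n` every class `[u]`, `u < 0`, is met with `b = -u`) and LANDHERR's
theorem as proved in the tree (`Motives/WeilHermitianLandherrUniqueness.exists_linearEquiv_weil_of_weilDiscriminant_eq`:
two alternating Weil forms of the same `K`-rank `2n`, both of signature `(n, n)`, with equal
discriminant are `K`-linearly isometric — van Geemen, LNM 1594, 5.4 with [L] = Landherr 1936;
Deligne–Milne Prop. 4.1: "determined up to isomorphism by its dimension, discriminant and signatures").

## What is proved (0 sorry)

* **`exists_typeII_operator_of_weilDiscriminant_eq`** — `K = ℚ + ℚ α`, `α² = -d < 0`, conjugation `σ`; `E`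
  an alternating `ℚ`-bilinear form of Weil type (`E(α x, α y) = d E(x, y)`) on a `K`-space `V` of
  `K`-dimension `2n` with `n` ODD, of signature `(n, n)` (subspaces `P`, `N`) and discriminant
  `det H = [u]` with `u < 0`. THEN `V` carries a `ℚ`-linear, `K`-ANTILINEAR operator `j` with `j² = -u`
  which is ROSATI-SYMMETRIC for `E` (`E(j x, y) = E(x, j y)`): transport `j = g⁻¹ j₀ g` of the model's
  operator along Landherr's isometry `g`. With `Motives/WeilDiscriminantTypeII` (such a `j` forces
  `det H = [(-j²)ⁿ]`) this is an EQUIVALENCE for odd `n`: the rational Weil data of odd half-rank `n` and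
  class `δ = [δ₀]`, `δ₀ < 0`, are exactly those admitting the indefinite quaternion algebra
  `D_δ = K ⊕ Kj = (-d, -δ₀)_ℚ` acting `K`-antilinearly through a Rosati-symmetric `j`.
  (For a polarized abelian `2n`-fold of Weil type, `n` odd — e.g. every SIXFOLD component `(3, K_d, δ)` —
  this is the statement that its RATIONAL polarized Weil datum `(H¹(X, ℚ), K, E)` is that of "type II for
  `D_δ`"; whether `j` comes from an endomorphism of some member of the component is a period-map /
  Riemann-theorem question not addressed here.)

## References

* [Landherr1936HermitianForms] W. Landherr, Äquivalenz Hermitescher Formen über einem beliebigen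
  algebraischen Zahlkörper, Abh. Math. Sem. Hamburg 11 (1936) 245–248.
* [vanGeemen1994HodgeAV] B. van Geemen, LNM 1594 (1994), Lemma 5.2 (2)–(4), 4.14, 5.4 and (5.4.1).
* [Deligne1982HodgeCycles] P. Deligne (notes by J. Milne), LNM 900 (1982), §4 Prop. 4.1.
* [vanGeemenVerra2003QuaternionicPryms] B. van Geemen, A. Verra, Topology 42 (2003), Lemma 4.5 (proof).
-/

noncomputable section

open Module

namespace Literature.AlgebraicGeometry.Motives

variable {K : Type} [Field K] [Algebra ℚ K] {α : K} {d : ℚ}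
  {V : Type} [AddCommGroup V] [Module ℚ V] [Module K V] [IsScalarTower ℚ K V] [Module.Finite K V]

/-- **Every alternating Weil form of odd half-rank `n`, signature `(n, n)` and NEGATIVE discriminant class
`[u]` carries a Rosati-symmetric `K`-antilinear `j` with `j² = -u`** (`D = K ⊕ Kj = (-d, -u)_ℚ`): Landherr
transport of the type-II model (`exists_typeII_weilModel_of_neg`) along the `K`-isometry of
`exists_linearEquiv_weil_of_weilDiscriminant_eq` (van Geemen 5.4 with [L]; Deligne–Milne Prop. 4.1).
Signature data in the format of that theorem (`K`-subspaces `P`, `N` of dimension `n`, `P ⊓ N = 0`,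
`Q > 0` on `P ∖ 0`, `Q < 0` on `N ∖ 0`, `Q(x) = E(x, α x)`). [cite: Landherr1936HermitianForms]
[cite: vanGeemen1994HodgeAV, 5.4 and (5.4.1), 4.14] [cite: Deligne1982HodgeCycles, §4 Prop. 4.1]
[cite: vanGeemenVerra2003QuaternionicPryms, Lemma 4.5 (proof)] -/
theorem exists_typeII_operator_of_weilDiscriminant_eq (E : LinearMap.BilinForm ℚ V) (σ : K →+* K)
    (hd : 0 < d) (hα : α * α = algebraMap ℚ K (-d)) (hσα : σ α = -α)
    (hK : ∀ k : K, ∃ a c : ℚ, k = algebraMap ℚ K a + algebraMap ℚ K c * α)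
    (hσ : ∀ k : K, k * σ k = algebraMap ℚ K (Algebra.norm ℚ k))
    (hE : ∀ x y : V, E x y = -E y x) (hW : ∀ x y : V, E (α • x) (α • y) = d * E x y)
    {n : ℕ} (hn : Odd n) (hV : finrank K V = 2 * n)
    (hsig : ∃ P N : Submodule K V, finrank K P = n ∧ finrank K N = n ∧ P ⊓ N = ⊥ ∧
      (∀ x ∈ P, x ≠ 0 → 0 < E x (α • x)) ∧ (∀ x ∈ N, x ≠ 0 → E x (α • x) < 0))
    (u : ℚˣ) (hu : (u : ℚ) < 0)
    (hdisc : weilDiscriminant E α = (QuotientGroup.mk u : ℚˣ ⧸ normUnitsSubgroup ℚ K)) :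
    ∃ j : V →ₗ[ℚ] V, (∀ x, j (α • x) = -(α • j x)) ∧ (∀ x, j (j x) = (-(u : ℚ)) • x) ∧
      (∀ x y, E (j x) y = E x (j y)) := by
  classical
  obtain ⟨E', j', hE', hW', -, hjα', hjj', hjE', hsig', hdisc'⟩ :=
    exists_typeII_weilModel_of_neg hd hα hK σ hσα hσ hn u hu
  have hV' : finrank K (Fin n ⊕ Fin n → K) = 2 * n := by
    rw [Module.finrank_fintype_fun_eq_card, Fintype.card_sum, Fintype.card_fin, two_mul]
  -- Landherr's `K`-isometry `g : (V, E) ≅ (Kⁿ × Kⁿ, E')`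
  obtain ⟨g, hg⟩ := exists_linearEquiv_weil_of_weilDiscriminant_eq σ hd hα hσα hK hσ n hn.pos V
    (Fin n ⊕ Fin n → K) hV hV' E E' hE hW hsig (fun x y => hE' y x) hW' hsig' (by rw [hdisc, hdisc'])
  -- transport `j = g⁻¹ j₀ g`
  refine ⟨(g.symm.toLinearMap.restrictScalars ℚ) ∘ₗ j' ∘ₗ (g.toLinearMap.restrictScalars ℚ),
    fun x => ?_, fun x => ?_, fun x y => ?_⟩
  · simp only [LinearMap.coe_comp, Function.comp_apply, LinearMap.coe_restrictScalars, LinearEquiv.coe_coe,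
      map_smul, hjα', map_neg]
  · simp only [LinearMap.coe_comp, Function.comp_apply, LinearMap.coe_restrictScalars, LinearEquiv.coe_coe,
      LinearEquiv.apply_symm_apply, hjj']
    rw [← LinearEquiv.coe_coe, LinearMap.map_smul_of_tower, LinearEquiv.coe_coe, LinearEquiv.symm_apply_apply]
  · simp only [LinearMap.coe_comp, Function.comp_apply, LinearMap.coe_restrictScalars, LinearEquiv.coe_coe]
    rw [← hg (g.symm (j' (g x))) y, LinearEquiv.apply_symm_apply, hjE', ← LinearEquiv.apply_symm_apply g (j' (g y)),
      hg, LinearEquiv.apply_symm_apply]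

/-- **Corollary (odd half-rank): the type-II structure exists for the discriminant of EVERY non-degenerate
Weil form of signature `(n, n)`** — no hypothesis on the class: `det H` of a signature-`(n, n)` form has
sign `(-1)ⁿ < 0` for odd `n` (van Geemen 4.14), so SOME `u < 0` represents it; stated with the
representative `u` as data (`hu`, `hdisc`) to keep the conclusion `j² = -u` explicit. This is
`exists_typeII_operator_of_weilDiscriminant_eq` re-exported under the name used by the route memos
("`(P₆)` holds on EVERY sixfold cell at the level of rational polarized Weil data").
[cite: vanGeemen1994HodgeAV, 4.14 and 5.4] [cite: Landherr1936HermitianForms] -/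
theorem exists_rosatiSymmetric_antilinear_of_odd (E : LinearMap.BilinForm ℚ V) (σ : K →+* K)
    (hd : 0 < d) (hα : α * α = algebraMap ℚ K (-d)) (hσα : σ α = -α)
    (hK : ∀ k : K, ∃ a c : ℚ, k = algebraMap ℚ K a + algebraMap ℚ K c * α)
    (hσ : ∀ k : K, k * σ k = algebraMap ℚ K (Algebra.norm ℚ k))
    (hE : ∀ x y : V, E x y = -E y x) (hW : ∀ x y : V, E (α • x) (α • y) = d * E x y)
    {n : ℕ} (hn : Odd n) (hV : finrank K V = 2 * n)
    (hsig : ∃ P N : Submodule K V, finrank K P = n ∧ finrank K N = n ∧ P ⊓ N = ⊥ ∧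
      (∀ x ∈ P, x ≠ 0 → 0 < E x (α • x)) ∧ (∀ x ∈ N, x ≠ 0 → E x (α • x) < 0))
    (u : ℚˣ) (hu : (u : ℚ) < 0)
    (hdisc : weilDiscriminant E α = (QuotientGroup.mk u : ℚˣ ⧸ normUnitsSubgroup ℚ K)) :
    ∃ (b : ℚ) (j : V →ₗ[ℚ] V), 0 < b ∧ (∀ x, j (α • x) = -(α • j x)) ∧ (∀ x, j (j x) = b • x) ∧
      (∀ x y, E (j x) y = E x (j y)) := by
  obtain ⟨j, h1, h2, h3⟩ :=
    exists_typeII_operator_of_weilDiscriminant_eq E σ hd hα hσα hK hσ hE hW hn hV hsig u hu hdisc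
  exact ⟨-(u : ℚ), j, neg_pos.2 hu, h1, h2, h3⟩

end Literature.AlgebraicGeometry.Motives

end
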